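import Summits.QuantumFields.YangMills.Theorems.UnitScaleTiltFluctuationComparisonRegPrGlobalSlackKernelLegDisplay
import HarnessLib

/-!
# `UnitScaleTiltFluctuationComparisonRegPrGlobalSlackKernelLegDisplayV3` — THE PER-RUN DISPLAY OBLIGATION FOR THE REGISTERED (v5k-B) STUB 3⁗ `stub_globalTwoRunSlackFam`, BY NAME
# (crux `FluctuationComparisonRegPrIntL`, stmt-QuantumFields-20520; the skeleton OF RECORD is v5k-B 3b016214180ca501 until C3 executes; width seat ym-ust-20520-w1 g0, count-neutral helper)

WHY.  This seat's display obligation `K1aLegRowsDisplayChi` (`…KernelLegDisplay`) concludes the χ-successor 3⁗χ of the OWNER's C3 pen v5kC.  Until C3 is executed the registry carries v5k-B,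
whose STUB 3⁗ reads the old package `AlphaInputsT3AC.PkgAtV3` / `OfV3At` / `dataOfV3 p π`.  Every row-level theorem of this seat's files is stated over a family of data CORES
`q : ∀ K, PkgCoreV3 …` or a generic datum `D`, and `dataOfV3 p π = dataOfCoreV3 (toCore ∘ p) π` (`rfl`), `canonPolymer p = canonPolymerCore (toCore ∘ p)`, `canonPT p = canonPTCore (toCore ∘ p)`
(lane B, p572847) — so the same obligation, with the token map reversed, serves the registered text:

* §1 **`K1aLegRowsDisplay L 𝔠 a₀ a₁ a`** — `K1aLegRowsDisplayChi` with `OfV3ChiAt ↦ OfV3At`, `PkgAtV3Chi ↦ PkgAtV3` (rows at `dataOfCoreV3 (toCore∘p) (canonPolymerCore (toCore∘p))`);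
* §2 **`k1aChartRowsK_of_display`** (`0 ≤ a`): the seven per-run rows ⟹ lane A's letter-free chart rows `K1aChartRowsK` (p545118) — K1a by the reference triangle (`2C`), the kernel size
  by Cauchy from leg-weighted analyticity, the residual row by the split ((M1)-exact + the far rows, ★w3's `abs_stepFar_le_theta7` inside), the configuration rows by the own-indexing
  transfers and the reference triangle, all carried to chart currency by the leg rescaling `(Φ∘D_w, D_w⁻¹B)` at the record's FULL decay `𝔠.κ`;
* §3 the capstone **`globalTwoRunSlackFam_of_k1aLegRowsDisplay : … → ⟨THE REGISTERED v5k-B TEXT OF `stub_globalTwoRunSlackFam` VERBATIM⟩`** (`globalTwoRunSlackFam_of_k1aChartRowsK`, p545118).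
HONEST FRAMING: reductions only; nothing of [Balaban1985UV3]/[King1986] asserted; the stub, the crux, both (α) records untouched; YM₃ on T³ is a rung, not the Clay problem / 𝕋⁴ / a mass gap.

References: T. Bałaban, CMP 102 (1985) 255–275 [Balaban1985UV3] ((25) p.262, (43)–(45) pp.266–267, (57) p.270); C. King, CMP 102 (1986) 649–677 [King1986] (Thm 3.4 (3.9) p.656,
Prop. 3.6 (3.56) p.662, Prop. 3.9 (3.71)–(3.74) pp.664–665).
-/

set_option autoImplicit false

noncomputable section

open scoped BigOperators
open Finset
open Literature.MathematicalPhysics.QuantumFieldTheory.Balaban1983to89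
open Literature.MathematicalPhysics.QuantumFieldTheory.Balaban1983to89.T3ContinuumYM3Torus
open Literature.MathematicalPhysics.QuantumFieldTheory.Balaban1983to89.T3UnitScaleTilt
open Literature.MathematicalPhysics.QuantumFieldTheory.Balaban1983to89.T3LevelShift
open Literature.MathematicalPhysics.QuantumFieldTheory.Balaban1983to89.T3AlphaInputsAC
open Literature.MathematicalPhysics.QuantumFieldTheory.Balaban1983to89.T3AlphaPolymerSocket
open Literature.MathematicalPhysics.QuantumFieldTheory.Balaban1983to89.T3AlphaInputsACTwoRun
open Literature.MathematicalPhysics.QuantumFieldTheory.Balaban1983to89.T3AlphaInputsACTwoRunLevel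
open Literature.MathematicalPhysics.QuantumFieldTheory.Balaban1983to89.B12TreeDecay (kappa₀ kappa₀_nonneg)
open Literature.MathematicalPhysics.QuantumFieldTheory.Balaban1985CMP102
open Literature.MathematicalPhysics.QuantumFieldTheory.Balaban1985CMP102.Setting
open Summit.QuantumFields.Balaban3D.Carriers
open Summit.QuantumFields.Balaban3D.Proofs.Primitives
open Summit.QuantumFields.Balaban3D.Proofs.GroupModelLieC (lieC)
open Summit.QuantumFields.YangMills.Theorems
open Summit.QuantumFields.YangMills.Theorems.GlobalSlackKernelMatching
open Summit.QuantumFields.YangMills.Theorems.GlobalSlackCanonicalPolymers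

namespace Summit.QuantumFields.YangMills.Theorems.GlobalSlackKernelLeg

/-! ## §1 The display obligation over the old (v5k-B) record -/

/-- **THE PER-RUN DISPLAY OBLIGATION FOR THE REGISTERED STUB 3⁗** (hypothesis schema, never asserted): `K1aLegRowsDisplayChi` with the token map reversed (`OfV3At`, `PkgAtV3`), rows at
the core datum of the projected family `toCore ∘ p`. [cite: King1986, Thm 3.4 (3.9) p.656, Prop. 3.6 (3.56) p.662, Prop. 3.9 (3.71)-(3.74) p.665; Balaban1985UV3, (25) p.262, (43)-(45) pp.266-267, (57) p.270] -/
def K1aLegRowsDisplay (L : ℕ) (𝔠 : AlphaConsts L (suGroupModel 2).N) (a₀ a₁ a : ℝ) : Prop :=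
  ∃ (κ' ρ C C_A C_Λ C_s C_B γB : ℝ), 0 < κ' ∧ 0 < ρ ∧ 0 ≤ C ∧ 0 ≤ C_A ∧ 0 ≤ C_Λ ∧ 0 ≤ C_s ∧ 0 ≤ C_B ∧ 0 < γB ∧
    ∀ (F : T3Family) (γ : ℝ) (hF : F.L = L) (hγ : 0 < γ), γ ≤ γB → ∀ (hγ1 : γ ≤ (min (hF ▸ 𝔠).gamma0 1) ^ 2),
      ∃ (Ψ : ChartFam ↥(lieC (suGroupModel 2)) F) (BR : CfgFam ↥(lieC (suGroupModel 2)) F), KerHeightFree Ψ ∧ RefCfgCoherent BR ∧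
        (AlphaInputsT3AC.OfV3At F (hF ▸ 𝔠) a₀ a₁ →
          ∃ (p : ∀ K, AlphaInputsT3AC.PkgAtV3 F (hF ▸ 𝔠) γ hγ hγ1 K), (∀ K, (p K).a₀ = a₀ ∧ (p K).a₁ = a₁) ∧
            ∃ (Φ : ChartFam ↥(lieC (suGroupModel 2)) F) (e : VacFam F) (B : CfgFam ↥(lieC (suGroupModel 2)) F),
              KernelRefOwnΦ (AlphaInputsT3AC.dataOfCoreV3 (fun K => (p K).toCore) (canonPolymerCore fun K => (p K).toCore)) Φ Ψ (canonLegDist F) κ' (hF ▸ 𝔠).κ a C ∧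
              ChartAnalyticΦ (AlphaInputsT3AC.dataOfCoreV3 (fun K => (p K).toCore) (canonPolymerCore fun K => (p K).toCore)) (rescaleΦw (canonLegDist F) κ' Φ) (hF ▸ 𝔠).κ ρ C_A ∧
              NewLevelIsBirth (fun K => (p K).toCore) Φ e B ∧
              OldTermsAreJetsOwn (fun K => (p K).toCore) Φ e B ∧
              LambdaFarSmallOwn (fun K => (p K).toCore) (hF ▸ 𝔠).b₀ (hF ▸ 𝔠).p₀ (hF ▸ 𝔠).κ C_Λ ∧
              CfgDistOwnΦ (AlphaInputsT3AC.dataOfCoreV3 (fun K => (p K).toCore) (canonPolymerCore fun K => (p K).toCore)) B (canonLegDist F) (hF ▸ 𝔠).b₀ (hF ▸ 𝔠).p₀ C_s ∧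
              CfgRefOwnΦ (AlphaInputsT3AC.dataOfCoreV3 (fun K => (p K).toCore) (canonPolymerCore fun K => (p K).toCore)) B BR (canonLegDist F) (hF ▸ 𝔠).b₀ (hF ▸ 𝔠).p₀ a C_B)

/-! ## §2 The seven per-run rows give lane A's letter-free chart rows -/

/-- **THE DISPLAY OBLIGATION GIVES `K1aChartRowsK`** (`0 ≤ a`): constants `C := 2C`, `C_E := C_A·max(1,12/ρ)⁶`, `C_R := stepFarConstL L 𝔠 + C_Λ`, `C_s·(1+κ′⁻¹)`, `2C_B·(1+κ′⁻¹)`; rows at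
`dataOfV3 p (canonPolymer p) = dataOfCoreV3 (toCore∘p) (canonPolymerCore (toCore∘p))`, term function `canonPT p = canonPTCore (toCore∘p)`, rest `residualRemCore`, charts/configurations
leg-rescaled. [cite: Balaban1985UV3, (43)-(45) pp.266-267, (57) p.270; King1986, Prop. 3.6 (3.56) p.662, Prop. 3.9 (3.71)-(3.74) p.665] -/
theorem k1aChartRowsK_of_display {L : ℕ} {𝔠 : AlphaConsts L (suGroupModel 2).N} {a₀ a₁ a : ℝ} (ha : 0 ≤ a) (h : K1aLegRowsDisplay L 𝔠 a₀ a₁ a) :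
    K1aChartRowsK L 𝔠 a₀ a₁ a := by
  obtain ⟨κ', ρ, C, C_A, C_Λ, C_s, C_B, γB, hκ', hρ, hC, hCA, hCΛ, hCs, hCB, hγB, hall⟩ := h
  have hk1 : 0 ≤ 1 + κ'⁻¹ := by positivity
  refine ⟨2 * C, C_A * (max 1 (12 / ρ)) ^ 6, stepFarConstL L 𝔠 + C_Λ, C_s * (1 + κ'⁻¹), 2 * C_B * (1 + κ'⁻¹), γB, by linarith, by positivity,
    add_nonneg (stepFarConstL_nonneg L 𝔠) hCΛ, mul_nonneg hCs hk1, by positivity, hγB, fun F γ hF hγ hγle hγ1 hOf => ?_⟩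
  subst hF
  obtain ⟨Ψ, BR, hΨ, hBR, himp⟩ := hall F γ rfl hγ hγle hγ1
  obtain ⟨p, hp, Φ, e, B, hK, hA, hN, hM1, hΛ, hS, hBC⟩ := himp hOf
  -- letters of the record
  have hL : 1 ≤ F.L := F.hL.2.le
  have hγ1' : γ ≤ 1 := hγ1.trans (sq_min_one_le _ 𝔠.gamma0_pos)
  have hn := canonLegDist_nonneg F
  have hm := canonLegDist_matched F
  have hκ0 : 0 ≤ 𝔠.κ := by
    have h0 : 0 ≤ kappa₀ (4 * 2 ^ 3) (2 * 3) := kappa₀_nonneg (by norm_num) _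
    linarith [𝔠.kappa_ge]
  -- the geometry of the core canonical polymerisation
  have hT := treeLenRefinedOn_canonCore fun K => (p K).toCore
  have hLoc := locMatched_canonCore fun K => (p K).toCore
  -- the leg rows of record at the core datum
  have hK1a := flatKernelLegCauchyΦ_of_ref hΨ (kernelRefΦ_of_own hm hT hκ0 hC ha hL hK)
  have hE := kernelLegΦ_of_chartAnalyticLeg hA
  have hR := remainderSmallΦ_of_own hLoc hT hκ0 (add_nonneg (stepFarConst_nonneg 𝔠) hCΛ) hL hγ hγ1' 𝔠.b₀_pos
    (remainderSmallOwnΦ_of_jets_lambda (fun K => (p K).toCore) hCΛ hN hM1 hΛ)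
  have hS' := cfgDistΦ_of_own hLoc hm hS
  have hBC' := cfgDistCauchyΦ_of_ref hBR (cfgRefΦ_of_own hLoc hm hn hL hγ hγ1' 𝔠.b₀_pos hCB ha hBC)
  -- to chart currency, at the old datum
  refine ⟨p, hp, ?_⟩
  rw [AlphaInputsT3AC.dataOfV3_eq_dataOfCoreV3, canonPolymer_eq_core, canonPT_eq_core]
  exact ⟨rescaleΦw (canonLegDist F) κ' Φ, e, rescaleBw (canonLegDist F) κ' B, residualRemCore (fun K => (p K).toCore) Φ e B,
    taylorSplitΦ_rescaleW (canonLegDist F) κ' (taylorSplitΦ_residualCore (fun K => (p K).toCore) Φ e B),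
    flatKernelCauchyΦ_rescaleW hm hK1a, kernelSizeΦ_rescaleW hE, hR,
    cfgSizeΦ_rescaleW hL hγ hγ1' 𝔠.b₀_pos hn hm hκ' hCs hS',
    by simpa [mul_assoc] using cfgCauchyΦ_rescaleW hL hγ hγ1' 𝔠.b₀_pos hn hm hκ' (by linarith : 0 ≤ 2 * C_B) hBC'⟩

/-! ## §3 The registered text, by name -/

/-- **THE REGISTERED (v5k-B) STUB 3⁗ FROM THE PER-RUN DISPLAY OBLIGATION, BY NAME** (`globalTwoRunSlackFam_of_k1aChartRowsK ∘ k1aChartRowsK_of_display`): if for every odd `L ≥ 7`, every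
constants record and [7]-constants there is a rate exponent `0 < a < 1` with `K1aLegRowsDisplay L 𝔠 a₀ a₁ a`, then the REGISTERED text of `stub_globalTwoRunSlackFam` (skeleton v5k-B of
stmt-QuantumFields-20520) holds VERBATIM. [cite: King1986, Thm 3.4 (3.9) p.656, Prop. 3.6 (3.56) p.662; Balaban1985UV3, (43)-(47) pp.266-267, (57) p.270] -/
theorem globalTwoRunSlackFam_of_k1aLegRowsDisplay
    (h : ∀ (L : ℕ), Odd L → 7 ≤ L → ∀ (𝔠 : AlphaConsts L (suGroupModel 2).N) (a₀ a₁ : ℝ), 0 < a₀ → 0 < a₁ → 𝔠.B₃ * a₁ ≤ a₀ →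
      ∃ a : ℝ, 0 < a ∧ a < 1 ∧ K1aLegRowsDisplay L 𝔠 a₀ a₁ a) :
    ∀ (L : ℕ), Odd L → 7 ≤ L → ∀ (𝔠 : Summit.QuantumFields.Balaban3D.Proofs.Primitives.AlphaConsts L (Summit.QuantumFields.Balaban3D.Carriers.suGroupModel 2).N)
      (a₀ a₁ : ℝ), 0 < a₀ → 0 < a₁ → 𝔠.B₃ * a₁ ≤ a₀ →
      ∃ a : ℝ, 0 < a ∧ ∃ γB : ℝ, 0 < γB ∧ ∀ (F : T3Family) (γ : ℝ) (hF : F.L = L) (hγ : 0 < γ), γ ≤ γB →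
        ∀ (hγ1 : γ ≤ (min (hF ▸ 𝔠).gamma0 1) ^ 2),
          Summit.QuantumFields.YangMills.Theorems.AlphaInputsT3AC.OfV3At F (hF ▸ 𝔠) a₀ a₁ →
          ∃ (p : ∀ K, Summit.QuantumFields.YangMills.Theorems.AlphaInputsT3AC.PkgAtV3 F (hF ▸ 𝔠) γ hγ hγ1 K),
            (∀ K, (p K).a₀ = a₀ ∧ (p K).a₁ = a₁) ∧
            ∃ (π : Summit.QuantumFields.YangMills.Theorems.AlphaInputsT3AC.PolymerT3 F) (σ : ℕ) (C : ℝ), 7 ≤ σ ∧ 0 ≤ C ∧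
              Summit.QuantumFields.YangMills.Theorems.GlobalSlack.GlobalSupRateTSlack (Summit.QuantumFields.YangMills.Theorems.AlphaInputsT3AC.dataOfV3 p π) (hF ▸ 𝔠).b₀ (hF ▸ 𝔠).p₀ a σ C :=
  globalTwoRunSlackFam_of_k1aChartRowsK fun L hLo h7 𝔠 a₀ a₁ ha0 ha1 hw => by
    obtain ⟨a, ha, ha1', hc⟩ := h L hLo h7 𝔠 a₀ a₁ ha0 ha1 hw
    exact ⟨a, ha, ha1', k1aChartRowsK_of_display ha.le hc⟩

end Summit.QuantumFields.YangMills.Theorems.GlobalSlackKernelLeg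

end
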